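import Literature.MathematicalPhysics.QuantumFieldTheory.CircleHaarAngle
import Literature.MathematicalPhysics.QuantumFieldTheory.LatticeGaugeProofs
import Literature.MathematicalPhysics.QuantumFieldTheory.U1WardIdentity
import Literature.MathematicalPhysics.QuantumLattice.AbelianFieldTensor
import HarnessLib

/-!
# `SelfNormalisedSkewness` — negative side: large plaquette angles are exponentially rare at weak coupling

Route `ScalingWindowSplit`, crux `stmt-QuantumFields-18944`, line `Sketch` (negation branch), support for the
lead's `stub_witnessAssembly`.  `U(1)` lattice gauge theory (`u1Rep`) on the torus `(ℤ/S)⁴` with Wilson's action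
`S(U) = Σ_p (1 − cos F_p)`:

* `haarProbability_circle_abs_arg_le` — the Haar probability of the arc `{|arg z| ≤ δ}` is `δ/π`;
* `pi_haar_smallLinks` — hence `Haar^E {∀ e, |arg U_e| ≤ δ} = (δ/π)^{|E|}`;
* `wilsonAction_u1_le_of_smallLinks` — on that set every plaquette has `1 − cos F_p ≤ 1 − cos 4δ` (`4δ ≤ π`);
* `partitionFunction_u1_ge` — the energy–entropy lower bound `Z ≥ (δ/π)^{|E|} e^{−β|P|(1 − cos 4δ)}`;
* `wilsonAction_u1_ge_of_largePlaquette` — a plaquette with `|F_p| ≥ ε` costs `S ≥ 1 − cos ε`;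
* `wilsonMeasure_u1_largePlaquette_le` — **the large-field bound**
  `μ_β{∃ p, |F_p| ≥ ε} ≤ e^{−β(1−cos ε)} (π/δ)^{|E|} e^{β|P|(1−cos 4δ)}`.

References: the union/energy–entropy bound is elementary (e.g. Guth 1980 §II for the strategy).  No definitions,
no named facts.
-/

noncomputable section

open scoped BigOperators ENNReal
open MeasureTheory Set
open Literature.MathematicalPhysics.QuantumLattice Literature.MathematicalPhysics.QuantumFieldTheory

namespace Summit.QuantumFields.YangMills.Theorems.SelfNormalisedSkewness.Negative

/-- The coercion `Circle → ℂ` is continuous. [folklore] -/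
theorem continuous_circle_coe : Continuous fun z : Circle => (z : ℂ) := continuous_subtype_val

/-- `z ↦ arg z` is measurable on the circle. [folklore] -/
theorem measurable_circle_arg : Measurable fun z : Circle => Complex.arg (z : ℂ) :=
  Complex.measurable_arg.comp continuous_circle_coe.measurable

/-- **Haar measure of an arc**: for `0 ≤ δ ≤ π`, `Haar{z ∈ U(1) : |arg z| ≤ δ} = δ/π`. [folklore] -/
theorem haarProbability_circle_abs_arg_le {δ : ℝ} (hδ : δ < Real.pi) :
    haarProbability Circle {z : Circle | |Complex.arg (z : ℂ)| ≤ δ} = ENNReal.ofReal (δ / Real.pi) := by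
  have hmeas : MeasurableSet {z : Circle | |Complex.arg (z : ℂ)| ≤ δ} :=
    measurableSet_le measurable_circle_arg.abs measurable_const
  rw [← CircleHaar.map_exp_angleMeasure, Measure.map_apply Circle.exp.continuous.measurable hmeas]
  have hpre : Circle.exp ⁻¹' {z : Circle | |Complex.arg (z : ℂ)| ≤ δ} ∩ Ioc (-Real.pi) Real.pi = Icc (-δ) δ := by
    ext θ
    simp only [mem_inter_iff, mem_preimage, mem_setOf_eq, mem_Ioc, mem_Icc]
    constructor
    · rintro ⟨h, h1, h2⟩
      rw [Circle.arg_exp h1 h2] at h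
      exact abs_le.1 h
    · rintro ⟨h1, h2⟩
      have hθ1 : -Real.pi < θ := by linarith
      have hθ2 : θ ≤ Real.pi := by linarith
      refine ⟨?_, hθ1, hθ2⟩
      rw [Circle.arg_exp hθ1 hθ2]
      exact abs_le.2 ⟨h1, h2⟩
  rw [CircleHaar.angleMeasure, Measure.smul_apply, Measure.restrict_apply' measurableSet_Ioc, hpre,
    Real.volume_Icc, smul_eq_mul]
  rw [show δ - -δ = 2 * δ by ring, ← ENNReal.ofReal_inv_of_pos (by positivity), ← ENNReal.ofReal_mul
    (by positivity)]
  congr 1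
  field_simp

/-- **Entropy of small links**: `Haar^E {U : ∀ e, |arg U_e| ≤ δ} = (δ/π)^{|E|}`. [folklore] -/
theorem pi_haar_smallLinks {E : Type} [Fintype E] {δ : ℝ} (hδ : δ < Real.pi) :
    (Measure.pi fun _ : E => haarProbability Circle) {U : E → Circle | ∀ e, |Complex.arg (U e : ℂ)| ≤ δ} =
      ENNReal.ofReal (δ / Real.pi) ^ Fintype.card E := by
  have hset : {U : E → Circle | ∀ e, |Complex.arg (U e : ℂ)| ≤ δ} =
      Set.pi univ fun _ : E => {z : Circle | |Complex.arg (z : ℂ)| ≤ δ} := by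
    ext U; simp
  rw [hset, Measure.pi_pi]
  simp only [haarProbability_circle_abs_arg_le hδ, Finset.prod_const, Finset.card_univ]

/-- The real part of a plaquette holonomy of `U(1)` in terms of link arguments:
`Re U_p = cos(θ₁ + θ₂ − θ₃ − θ₄)`. [folklore] -/
theorem re_plaquetteHolonomy_u1_eq_cos {d L : ℕ} (U : GaugeConfig d L Circle) (x : Site d L) (i j : Fin d) :
    ((plaquetteHolonomy U x i j : Circle) : ℂ).re =
      Real.cos (Complex.arg (U (x, i) : ℂ) + Complex.arg (U (x.shift i, j) : ℂ) -
        Complex.arg (U (x.shift j, i) : ℂ) - Complex.arg (U (x, j) : ℂ)) := by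
  have key : (plaquetteHolonomy U x i j : Circle) =
      Circle.exp (Complex.arg (U (x, i) : ℂ) + Complex.arg (U (x.shift i, j) : ℂ) -
        Complex.arg (U (x.shift j, i) : ℂ) - Complex.arg (U (x, j) : ℂ)) := by
    rw [plaquetteHolonomy, Circle.exp_sub, Circle.exp_sub, Circle.exp_add, Circle.exp_arg, Circle.exp_arg,
      Circle.exp_arg, Circle.exp_arg, div_eq_mul_inv, div_eq_mul_inv]
  rw [key, Circle.coe_exp]
  exact Complex.exp_ofReal_mul_I_re _

/-- **Small links make small plaquettes**: if every link has `|arg U_e| ≤ δ` with `4δ ≤ π`, then every plaquette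
term of Wilson's `U(1)` action is at most `1 − cos 4δ`, so `S(U) ≤ |P| (1 − cos 4δ)`. [folklore] -/
theorem wilsonAction_u1_le_of_smallLinks {L : ℕ} [NeZero L] {δ : ℝ} (h4 : 4 * δ ≤ Real.pi)
    {U : GaugeConfig 4 L Circle} (hU : ∀ e, |Complex.arg (U e : ℂ)| ≤ δ) :
    wilsonAction u1Rep U ≤ Fintype.card (Plaquette 4 L) * (1 - Real.cos (4 * δ)) := by
  rw [wilsonAction_u1_eq]
  calc ∑ p : Plaquette 4 L, (1 - ((plaquetteHolonomy U p.1 p.2.1.1 p.2.1.2 : Circle) : ℂ).re)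
      ≤ ∑ _p : Plaquette 4 L, (1 - Real.cos (4 * δ)) := Finset.sum_le_sum fun p _ => ?_
    _ = _ := by rw [Finset.sum_const, Finset.card_univ, nsmul_eq_mul]
  rw [re_plaquetteHolonomy_u1_eq_cos]
  set t := Complex.arg (U (p.1, p.2.1.1) : ℂ) + Complex.arg (U (p.1.shift p.2.1.1, p.2.1.2) : ℂ) -
    Complex.arg (U (p.1.shift p.2.1.2, p.2.1.1) : ℂ) - Complex.arg (U (p.1, p.2.1.2) : ℂ)
  have ht : |t| ≤ 4 * δ := by
    have h1 := hU (p.1, p.2.1.1); have h2 := hU (p.1.shift p.2.1.1, p.2.1.2)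
    have h3 := hU (p.1.shift p.2.1.2, p.2.1.1); have h4 := hU (p.1, p.2.1.2)
    calc |t| ≤ |Complex.arg (U (p.1, p.2.1.1) : ℂ) + Complex.arg (U (p.1.shift p.2.1.1, p.2.1.2) : ℂ) -
          Complex.arg (U (p.1.shift p.2.1.2, p.2.1.1) : ℂ)| + |Complex.arg (U (p.1, p.2.1.2) : ℂ)| := abs_sub _ _
      _ ≤ (|Complex.arg (U (p.1, p.2.1.1) : ℂ) + Complex.arg (U (p.1.shift p.2.1.1, p.2.1.2) : ℂ)| +
          |Complex.arg (U (p.1.shift p.2.1.2, p.2.1.1) : ℂ)|) + |Complex.arg (U (p.1, p.2.1.2) : ℂ)| := by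
          gcongr; exact abs_sub _ _
      _ ≤ ((|Complex.arg (U (p.1, p.2.1.1) : ℂ)| + |Complex.arg (U (p.1.shift p.2.1.1, p.2.1.2) : ℂ)|) +
          |Complex.arg (U (p.1.shift p.2.1.2, p.2.1.1) : ℂ)|) + |Complex.arg (U (p.1, p.2.1.2) : ℂ)| := by
          gcongr; exact abs_add_le _ _
      _ ≤ ((δ + δ) + δ) + δ := by gcongr
      _ = 4 * δ := by ring
  have hcos : Real.cos (4 * δ) ≤ Real.cos t := by
    rw [← Real.cos_abs t]
    exact Real.cos_le_cos_of_nonneg_of_le_pi (abs_nonneg t) h4 ht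
  linarith

/-- **Energy–entropy lower bound on the `U(1)` partition function**: for `β ≥ 0`, `0 ≤ δ`, `4δ ≤ π`,
`Z_{Λ,β} ≥ (δ/π)^{|E|} · e^{−β |P| (1 − cos 4δ)}`. [folklore] -/
theorem partitionFunction_u1_ge {L : ℕ} [NeZero L] {β δ : ℝ} (hβ : 0 ≤ β) (h4 : 4 * δ ≤ Real.pi) :
    ENNReal.ofReal (δ / Real.pi) ^ Fintype.card (Edge 4 L) *
        ENNReal.ofReal (Real.exp (-(β * (Fintype.card (Plaquette 4 L) * (1 - Real.cos (4 * δ)))))) ≤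
      partitionFunction (d := 4) (L := L) u1Rep β := by
  have hδπ : δ < Real.pi := by linarith [Real.pi_pos]
  set B : Set (GaugeConfig 4 L Circle) := {U | ∀ e, |Complex.arg (U e : ℂ)| ≤ δ} with hB
  have hBm : MeasurableSet B := by
    have : B = ⋂ e, {U : GaugeConfig 4 L Circle | |Complex.arg (U e : ℂ)| ≤ δ} := by ext U; simp [hB]
    rw [this]
    exact MeasurableSet.iInter fun e => measurableSet_le
      ((measurable_circle_arg.comp (measurable_pi_apply e)).abs) measurable_const
  simp only [partitionFunction, wilsonWeight, withDensity_apply _ MeasurableSet.univ, Measure.restrict_univ]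
  calc ENNReal.ofReal (δ / Real.pi) ^ Fintype.card (Edge 4 L) *
        ENNReal.ofReal (Real.exp (-(β * (Fintype.card (Plaquette 4 L) * (1 - Real.cos (4 * δ))))))
      = ∫⁻ _U in B, ENNReal.ofReal (Real.exp (-(β * (Fintype.card (Plaquette 4 L) * (1 - Real.cos (4 * δ))))))
          ∂(Measure.pi fun _ : Edge 4 L => haarProbability Circle) := by
        rw [setLIntegral_const, pi_haar_smallLinks hδπ, mul_comm]
    _ ≤ ∫⁻ U in B, ENNReal.ofReal (Real.exp (-β * wilsonAction u1Rep U))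
          ∂(Measure.pi fun _ : Edge 4 L => haarProbability Circle) := by
        refine setLIntegral_mono' hBm fun U hU => ENNReal.ofReal_le_ofReal (Real.exp_le_exp.2 ?_)
        rw [neg_mul, neg_le_neg_iff]
        exact mul_le_mul_of_nonneg_left (wilsonAction_u1_le_of_smallLinks h4 hU) hβ
    _ ≤ ∫⁻ U, ENNReal.ofReal (Real.exp (-β * wilsonAction u1Rep U))
          ∂(Measure.pi fun _ : Edge 4 L => haarProbability Circle) := setLIntegral_le_lintegral _ _

/-- **A large plaquette angle costs action**: if `ε ≤ |F_p(U)|` for some plaquette (`0 ≤ ε`), then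
`S(U) ≥ 1 − cos ε`. [folklore] -/
theorem wilsonAction_u1_ge_of_largePlaquette {L : ℕ} [NeZero L] {ε : ℝ} (h0 : 0 ≤ ε)
    {U : GaugeConfig 4 L Circle} {p : Plaquette 4 L} (hp : ε ≤ |abelianFieldTensor U p.1 p.2.1.1 p.2.1.2|) :
    1 - Real.cos ε ≤ wilsonAction u1Rep U := by
  rw [wilsonAction_u1_eq]
  have hterm : ∀ q : Plaquette 4 L, 0 ≤ 1 - ((plaquetteHolonomy U q.1 q.2.1.1 q.2.1.2 : Circle) : ℂ).re :=
    fun q => by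
      have := Complex.re_le_norm ((plaquetteHolonomy U q.1 q.2.1.1 q.2.1.2 : Circle) : ℂ)
      rw [Circle.norm_coe] at this
      linarith
  calc 1 - Real.cos ε ≤ 1 - ((plaquetteHolonomy U p.1 p.2.1.1 p.2.1.2 : Circle) : ℂ).re := by
        rw [← exp_abelianFieldTensor, Circle.coe_exp, Complex.exp_ofReal_mul_I_re,
          ← Real.cos_abs (abelianFieldTensor _ _ _ _)]
        have := Real.cos_le_cos_of_nonneg_of_le_pi h0 (abs_abelianFieldTensor_le_pi U p.1 p.2.1.1 p.2.1.2) hp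
        linarith
    _ ≤ ∑ q : Plaquette 4 L, (1 - ((plaquetteHolonomy U q.1 q.2.1.1 q.2.1.2 : Circle) : ℂ).re) :=
        Finset.single_le_sum (fun q _ => hterm q) (Finset.mem_univ p)

/-- The large-plaquette event is measurable. [folklore] -/
theorem measurableSet_largePlaquette {L : ℕ} [NeZero L] (ε : ℝ) :
    MeasurableSet {U : GaugeConfig 4 L Circle | ∃ p : Plaquette 4 L, ε ≤ |abelianFieldTensor U p.1 p.2.1.1 p.2.1.2|} := by
  have : {U : GaugeConfig 4 L Circle | ∃ p : Plaquette 4 L, ε ≤ |abelianFieldTensor U p.1 p.2.1.1 p.2.1.2|} =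
      ⋃ p : Plaquette 4 L, {U | ε ≤ |abelianFieldTensor U p.1 p.2.1.1 p.2.1.2|} := by ext U; simp
  rw [this]
  refine MeasurableSet.iUnion fun p => measurableSet_le measurable_const ?_
  exact (measurable_circle_arg.comp (measurable_plaquetteHolonomy p.1 p.2.1.1 p.2.1.2)).abs

/-- **The large-field bound.**  For `U(1)` on `(ℤ/S)⁴` at inverse coupling `β ≥ 0`, `0 ≤ ε`, `0 ≤ δ`,
`4δ ≤ π`: `μ_β{∃ p, |F_p| ≥ ε} ≤ e^{−β(1−cos ε)} · (δ/π)^{−|E|} · e^{β|P|(1−cos 4δ)}` — the Boltzmann factor of one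
large plaquette against the entropy of the small-link neighbourhood of the trivial configuration that bounds `Z`
from below (`partitionFunction_u1_ge`). [folklore] -/
theorem wilsonMeasure_u1_largePlaquette_le {L : ℕ} [NeZero L] {β ε δ : ℝ} (hβ : 0 ≤ β) (hε : 0 ≤ ε)
    (hδ0 : 0 < δ) (h4 : 4 * δ ≤ Real.pi) :
    (wilsonMeasure u1Rep β : Measure (GaugeConfig 4 L Circle))
        {U : GaugeConfig 4 L Circle | ∃ p : Plaquette 4 L, ε ≤ |abelianFieldTensor U p.1 p.2.1.1 p.2.1.2|} ≤
      ENNReal.ofReal (Real.exp (-(β * (1 - Real.cos ε)))) *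
        ((ENNReal.ofReal (δ / Real.pi) ^ Fintype.card (Edge 4 L))⁻¹ *
          ENNReal.ofReal (Real.exp (β * (Fintype.card (Plaquette 4 L) * (1 - Real.cos (4 * δ)))))) := by
  set A := {U : GaugeConfig 4 L Circle | ∃ p : Plaquette 4 L, ε ≤ |abelianFieldTensor U p.1 p.2.1.1 p.2.1.2|}
  have hAm : MeasurableSet A := measurableSet_largePlaquette ε
  set π₀ : Measure (GaugeConfig 4 L Circle) := Measure.pi fun _ : Edge 4 L => haarProbability Circle with hπ₀
  haveI : IsProbabilityMeasure π₀ := by rw [hπ₀]; infer_instance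
  -- numerator
  have hnum : wilsonWeight (d := 4) (L := L) u1Rep β A ≤ ENNReal.ofReal (Real.exp (-(β * (1 - Real.cos ε)))) := by
    simp only [wilsonWeight, withDensity_apply _ hAm]
    calc ∫⁻ U in A, ENNReal.ofReal (Real.exp (-β * wilsonAction u1Rep U)) ∂π₀
        ≤ ∫⁻ _U in A, ENNReal.ofReal (Real.exp (-(β * (1 - Real.cos ε)))) ∂π₀ := by
          refine setLIntegral_mono measurable_const fun U hU => ENNReal.ofReal_le_ofReal (Real.exp_le_exp.2 ?_)
          obtain ⟨p, hp⟩ := hU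
          rw [neg_mul, neg_le_neg_iff]
          exact mul_le_mul_of_nonneg_left (wilsonAction_u1_ge_of_largePlaquette hε hp) hβ
      _ = ENNReal.ofReal (Real.exp (-(β * (1 - Real.cos ε)))) * π₀ A := setLIntegral_const _ _
      _ ≤ ENNReal.ofReal (Real.exp (-(β * (1 - Real.cos ε)))) * 1 := by gcongr; exact prob_le_one
      _ = _ := mul_one _
  -- denominator
  have hZ := partitionFunction_u1_ge (L := L) hβ h4
  have hE0 : ENNReal.ofReal (δ / Real.pi) ^ Fintype.card (Edge 4 L) ≠ 0 :=
    pow_ne_zero _ ((ENNReal.ofReal_pos.2 (div_pos hδ0 Real.pi_pos)).ne')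
  have hEtop : ENNReal.ofReal (δ / Real.pi) ^ Fintype.card (Edge 4 L) ≠ ∞ := ENNReal.pow_ne_top ENNReal.ofReal_ne_top
  have hexp0 : ENNReal.ofReal (Real.exp (-(β * (Fintype.card (Plaquette 4 L) * (1 - Real.cos (4 * δ)))))) ≠ 0 :=
    (ENNReal.ofReal_pos.2 (Real.exp_pos _)).ne'
  have hZ0 : partitionFunction (d := 4) (L := L) u1Rep β ≠ 0 := by
    intro h; rw [h] at hZ
    exact (mul_ne_zero hE0 hexp0) (le_zero_iff.1 hZ)
  have hZinv : (partitionFunction (d := 4) (L := L) u1Rep β)⁻¹ ≤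
      (ENNReal.ofReal (δ / Real.pi) ^ Fintype.card (Edge 4 L))⁻¹ *
        ENNReal.ofReal (Real.exp (β * (Fintype.card (Plaquette 4 L) * (1 - Real.cos (4 * δ))))) := by
    calc (partitionFunction (d := 4) (L := L) u1Rep β)⁻¹
        ≤ (ENNReal.ofReal (δ / Real.pi) ^ Fintype.card (Edge 4 L) *
            ENNReal.ofReal (Real.exp (-(β * (Fintype.card (Plaquette 4 L) * (1 - Real.cos (4 * δ)))))))⁻¹ :=
          ENNReal.inv_le_inv.2 hZ
      _ = _ := by
          rw [ENNReal.mul_inv (Or.inl hE0) (Or.inl hEtop), ← ENNReal.ofReal_inv_of_pos (Real.exp_pos _),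
            ← Real.exp_neg, neg_neg]
  calc (wilsonMeasure (d := 4) (L := L) u1Rep β) A
      = (partitionFunction (d := 4) (L := L) u1Rep β)⁻¹ * wilsonWeight (d := 4) (L := L) u1Rep β A := by
        simp only [wilsonMeasure, Measure.smul_apply, smul_eq_mul]
    _ ≤ ((ENNReal.ofReal (δ / Real.pi) ^ Fintype.card (Edge 4 L))⁻¹ *
          ENNReal.ofReal (Real.exp (β * (Fintype.card (Plaquette 4 L) * (1 - Real.cos (4 * δ)))))) *
        ENNReal.ofReal (Real.exp (-(β * (1 - Real.cos ε)))) := mul_le_mul' hZinv hnum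
    _ = _ := mul_comm _ _

end Summit.QuantumFields.YangMills.Theorems.SelfNormalisedSkewness.Negative

end
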